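import Literature.Computability.QuantumComplexity.SeqChain
import Literature.Computability.QuantumComplexity.CopyDesc
import HarnessLib

/-!
# Sequential chains of a circuit family, III: uniformity

Topic `Literature/Computability/QuantumComplexity`; sequel of `SeqChain.lean` / `SeqChainLaw.lean`.
By `QCircuitFamily.isUniform_of_descFn_mem_FP` it suffices that the description
`1ⁿ ↦ ⟨bin n, ⟨1^{anc n}, encode (circ n)⟩⟩` of the chain family is in `FP`. `encode (circ n)` is
the concatenation over the stages `k < T(n)` of the description bits of

* the input assembly `progIn n k` — the doubling copy of `x`, the constant ones of the pairing
  pattern, and the shifted copy of the window of block `k-1` (`CopyDesc.dupDescFn`, `notBitsFn`,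
  `notsDescFn`, `shiftDescFn` at offsets computed from `n` and `1ᵏ` in unary and then in binary),
* the conjugating swap (`SwapDesc.swapDescFn` at offset `Bw (k+1)`), the description of the stage
  `S.circ (il n k)` VERBATIM (the body of `S.descFn ∈ FP` at `1^{il n k}`), and the swap again,

folded over `k` by the counted concatenation fold with a ruler bounding the pieces (the bounds come
from `exists_poly_length_le_of_mem_FP` for the six string functions, applied to inputs not involving
the ruler), followed by the final swap (Arora–Barak 2009, §6.2 and Remark 6.7: descriptions printed
with counters). Main result: **`SeqChain.family_isUniform`**. Template: `PolyCopiesIdxUniform.lean`.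

## References

* S. Arora, B. Barak, *Computational Complexity: A Modern Approach*, CUP 2009, §1.3 (bounded loops),
  §6.1–6.2, Def. 6.12, Remark 6.7 [AroraBarak2009].
* E. Bernstein, U. Vazirani, *Quantum complexity theory*, SIAM J. Comput. 26 (1997), §8
  [BernsteinVazirani1997].
-/

noncomputable section

namespace Literature.Computability.QuantumComplexity

namespace SeqChain

open _root_.Computability Complexity Cryptography RevSim RevMux Function Matrix Finset

variable (P : Params)

section Uniform

open Polynomial Complexity.Brick Plumb RevDesc RevClean CopyDesc HashBricks

/-! ### Stage descriptions are program descriptions -/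

section Desc

variable {P}

/-- The description bits of a clamped compiled program are the `opBits` of the program.
[cite: AroraBarak2009, §6.1 (descriptions of circuits)] -/
theorem flatMap_gateEnc_clamp (n : ℕ) (ops : List (ClOp ℕ)) (hlt : ∀ op ∈ ops, ∀ i ∈ wiresOf op, i < n + anc P n)
    (hwf : ∀ op ∈ ops, op.WF) :
    (revCompile (clamp P n ops hlt hwf)).flatMap gateEnc = ops.flatMap opBits :=
  flatMap_gateEnc_revCompile_toRevList (width_pos n) ops hlt _

/-- The input assembly describes as `progIn` (for `k < T n`). [folklore] -/
theorem flatMap_gateEnc_inGates {n k : ℕ} (hk : k < Tn P n) :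
    (inGates P n k).flatMap gateEnc = (progIn P n k).flatMap opBits := by
  unfold inGates; rw [dif_pos hk]; exact flatMap_gateEnc_clamp n _ _ _

/-- The conjugating swap describes as `progConj` (for `k < T n`). [folklore] -/
theorem flatMap_gateEnc_conjGates {n k : ℕ} (hk : k < Tn P n) :
    (conjGates P n k).flatMap gateEnc = (progConj P n k).flatMap opBits := by
  unfold conjGates; rw [dif_pos hk]; exact flatMap_gateEnc_clamp n _ _ _

/-- The stage describes as the stage circuit, verbatim (for `k < T n`). [cite: AroraBarak2009, §6.2 (a circuit for each input length, hard-wired)] -/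
theorem flatMap_gateEnc_copyGates {n k : ℕ} (hk : k < Tn P n) :
    (copyGates P n k).flatMap gateEnc = (P.S.circ (il P n k)).encode := by
  unfold copyGates
  rw [dif_pos hk, show (P.S.circ (il P n k)).encode = QCircuit.encode (⟨(P.S.circ (il P n k)).gates⟩ : QCircuit cliffordT _) from rfl,
    encode_eq_flatMap]
  simp only [mapWires, List.flatMap_map]
  exact List.flatMap_congr fun g _ => CWrap.gateEnc_mapWiresGate_castLEEmb _ g

/-! ### The `opBits` of the input assembly, as concatenations -/

/-- Pairs of consecutive positions. [folklore] -/
theorem flatMap_opBits_map_range_two_mul (f : ℕ → ClOp ℕ) : ∀ n : ℕ,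
    ((List.range (2 * n)).map f).flatMap opBits = ccat (fun i => opBits (f (2 * i)) ++ opBits (f (2 * i + 1))) n
  | 0 => rfl
  | n + 1 => by
    rw [show 2 * (n + 1) = 2 * n + 1 + 1 by ring, List.range_succ, List.range_succ, List.map_append, List.map_append,
      List.flatMap_append, List.flatMap_append, flatMap_opBits_map_range_two_mul f n, ccat_succ]
    simp [List.append_assoc]

/-- A mapped range as a `ccat`. [folklore] -/
theorem flatMap_opBits_map_range (f : ℕ → ClOp ℕ) (L : ℕ) :
    ((List.range L).map f).flatMap opBits = ccat (fun j => opBits (f j)) L := by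
  rw [List.flatMap_map]
  exact CWrap.flatMap_range_eq_ccat _ L

/-- **The description bits of the input assembly of stage `k`** (`D = blk k 0`, `S₀ = blk (k-1) 0`):
the doubling copy, `NOT (D+2n+1)`, the run `NOT (D+2n+2+j)` (`j < 2k`), `NOT (D+2n+2k+3)`, the shifted
copy of the window. [cite: AroraBarak2009, §6.1] -/
theorem flatMap_opBits_progIn (n k : ℕ) :
    (progIn P n k).flatMap opBits =
      ccat (fun i => opBits (ClOp.cnot i (blk P n k 0 + 2 * i)) ++ opBits (ClOp.cnot i (blk P n k 0 + (2 * i + 1)))) n ++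
      (opBits (ClOp.not (blk P n k 0 + (2 * n + 1))) ++
        (ccat (fun j => opBits (ClOp.not (blk P n k 0 + (2 * n + 2) + j))) (2 * k) ++
          (opBits (ClOp.not (blk P n k 0 + (2 * n + 2 * k + 3))) ++
            ccat (fun j => opBits (ClOp.cnot (blk P n (k - 1) 0 + j) (blk P n k 0 + (2 * n + 2 * k + 4) + j))) (yl P n k)))) := by
  have hX : ((List.range (2 * n)).map (mkOp P n k)).flatMap opBits =
      ccat (fun i => opBits (ClOp.cnot i (blk P n k 0 + 2 * i)) ++ opBits (ClOp.cnot i (blk P n k 0 + (2 * i + 1)))) n := by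
    rw [flatMap_opBits_map_range_two_mul]
    refine ccat_congr fun i hi => ?_
    have h1 : mkOp P n k (2 * i) = ClOp.cnot i (blk P n k 0 + 2 * i) := by
      unfold mkOp; rw [if_pos (by omega), blk_eq_add n k (2 * i)]; congr 1; omega
    have h2 : mkOp P n k (2 * i + 1) = ClOp.cnot i (blk P n k 0 + (2 * i + 1)) := by
      unfold mkOp; rw [if_pos (by omega), blk_eq_add n k (2 * i + 1)]; congr 1; omega
    rw [h1, h2]
  have hnot : ∀ q, 2 * n ≤ q → q < 2 * n + 2 * k + 4 → mkOp P n k q = ClOp.not (blk P n k 0 + q) := by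
    intro q h1 h2; unfold mkOp; rw [if_neg (by omega), if_pos h2, blk_eq_add n k q]
  have hC : ((onesPos n k).map (mkOp P n k)).flatMap opBits =
      opBits (ClOp.not (blk P n k 0 + (2 * n + 1))) ++
        (ccat (fun j => opBits (ClOp.not (blk P n k 0 + (2 * n + 2) + j))) (2 * k) ++
          opBits (ClOp.not (blk P n k 0 + (2 * n + 2 * k + 3)))) := by
    rw [onesPos, List.cons_append, List.map_cons, List.flatMap_cons, List.map_append, List.flatMap_append,
      List.map_map, hnot _ (by omega) (by omega), List.map_cons, List.map_nil, List.flatMap_cons, List.flatMap_nil,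
      List.append_nil, hnot _ (by omega) (by omega)]
    congr 2
    rw [show (mkOp P n k ∘ fun j => 2 * n + 2 + j) = fun j => mkOp P n k (2 * n + 2 + j) from rfl]
    rw [show (List.map (fun j => mkOp P n k (2 * n + 2 + j)) (List.range (2 * k))).flatMap opBits =
        ccat (fun j => opBits (mkOp P n k (2 * n + 2 + j))) (2 * k) from flatMap_opBits_map_range _ _]
    refine ccat_congr fun j hj => ?_
    rw [hnot _ (by omega) (by omega)]
    congr 2; omega
  have hY : (((List.range (yl P n k)).map fun j => 2 * n + 2 * k + 4 + j).map (mkOp P n k)).flatMap opBits =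
      ccat (fun j => opBits (ClOp.cnot (blk P n (k - 1) 0 + j) (blk P n k 0 + (2 * n + 2 * k + 4) + j))) (yl P n k) := by
    rw [List.map_map, show (mkOp P n k ∘ fun j => 2 * n + 2 * k + 4 + j) = fun j => mkOp P n k (2 * n + 2 * k + 4 + j) from rfl,
      flatMap_opBits_map_range]
    refine ccat_congr fun j hj => ?_
    unfold mkOp
    rw [if_neg (by omega), if_neg (by omega), blk_eq_add n (k - 1), blk_eq_add n k, Nat.add_sub_cancel_left]
    congr 2; omega
  rw [progIn, posAll, List.map_append, List.map_append, List.flatMap_append, List.flatMap_append, hX, hC, hY]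
  simp only [List.append_assoc]

/-- The conjugating pairs are `(i, D + i)`, `D = blk k 0`. [folklore] -/
theorem conjPairs_eq (n k : ℕ) : conjPairs P n k = (List.range (Bw P n)).map fun i => (i, blk P n k 0 + i) := by
  unfold conjPairs
  exact List.map_congr_left fun i _ => by rw [blk_eq_add n k i]

/-- **The description bits of the conjugating swap** are those printed by `swapDescFn`. [folklore] -/
theorem flatMap_opBits_progConj (n k : ℕ) :
    (progConj P n k).flatMap opBits = SwapDesc.swapDescFn (boolPair (encodeNat (blk P n k 0)) (ones (Bw P n))) := by
  rw [SwapDesc.swapDescFn_apply, progConj, conjPairs_eq]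
  rfl

end Desc

/-! ### The layout as polynomials -/

/-- `Lmax` as a polynomial. [folklore] -/
def LmaxPoly : Polynomial ℕ := C 2 * X + C 2 * P.T + C 4 + P.m

/-- `Bw` as a polynomial. [folklore] -/
def BwPoly : Polynomial ℕ := LmaxPoly P + P.pS.comp (LmaxPoly P) + 1

/-- `W` as a polynomial. [folklore] -/
def WPoly : Polynomial ℕ := BwPoly P + P.T * BwPoly P

variable {P}

/-- Value of `LmaxPoly`. [folklore] -/
@[simp] theorem eval_LmaxPoly (n : ℕ) : (LmaxPoly P).eval n = Lmax P n := by
  simp [LmaxPoly, Lmax, Tn, mn]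

/-- Value of `BwPoly`. [folklore] -/
@[simp] theorem eval_BwPoly (n : ℕ) : (BwPoly P).eval n = Bw P n := by
  simp [BwPoly, Bw, Polynomial.eval_comp]

/-- Value of `WPoly`. [folklore] -/
@[simp] theorem eval_WPoly (n : ℕ) : (WPoly P).eval n = W P n := by
  simp [WPoly, W, base, Tn]

/-! ### The unary and binary quantities of a piece -/

section Piece

variable (P)

/-- The input field of the fold record `⟨⟨z, ruler⟩, 1ᵏ⟩ ↦ z`. [folklore] -/
def zF : List Bool → List Bool := fstF ∘ fstF

/-- `1^{Bw n}`. [folklore] -/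
def BwU : List Bool → List Bool := polyFn (BwPoly P) ∘ zF

/-- `1^{D}`, `D = blk k 0 = Bw (k+1)`. [folklore] -/
def DU : List Bool → List Bool := umulFn ∘ fanoutFn (BwU P) (List.cons true ∘ sndF)

/-- `1^{S₀}`, `S₀ = Bw · k = blk (k-1) 0` (for `k ≥ 1`). [folklore] -/
def SU : List Bool → List Bool := umulFn ∘ fanoutFn (BwU P) sndF

/-- `1ⁿ` (whatever the input string `z` of length `n` is). [folklore] -/
def nU : List Bool → List Bool := polyFn X ∘ zF

/-- `1^{2n}`. [folklore] -/
def twoNU : List Bool → List Bool := polyFn (C 2 * X) ∘ zF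

/-- `1^{2k}`. [folklore] -/
def twoKU : List Bool → List Bool := appF ∘ fanoutFn sndF sndF

/-- `1^{|y_k|}`: nothing for `k = 0`, `1^{m n}` afterwards. [folklore] -/
def ylU : List Bool → List Bool :=
  iteFn (ltLenF ∘ fanoutFn (fun _ => []) sndF) (polyFn P.m ∘ zF) (fun _ => [])

/-- `1^{D + 2n + 1}`. [folklore] -/
def pos1U : List Bool → List Bool := appF ∘ fanoutFn (DU P) (List.cons true ∘ twoNU)

/-- `1^{D + 2n + 2}`. [folklore] -/
def pos2U : List Bool → List Bool := List.cons true ∘ pos1U P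

/-- `1^{D + 2n + 2k + 3}`. [folklore] -/
def pos3U : List Bool → List Bool := List.cons true ∘ appF ∘ fanoutFn (pos2U P) (twoKU)

/-- `1^{D + 2n + 2k + 4}`. [folklore] -/
def pos4U : List Bool → List Bool := List.cons true ∘ pos3U P

/-- `1^{il n k}`: `z z 1^{2k} 1111 1^{|y_k|}`. [folklore] -/
def ilU : List Bool → List Bool :=
  appF ∘ fanoutFn (twoNU) (appF ∘ fanoutFn (twoKU) (appF ∘ fanoutFn (fun _ => ones 4) (ylU P)))

/-- **The description of the input assembly of stage `k`**, as a string function of the record. [folklore] -/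
def inF : List Bool → List Bool :=
  appF ∘ fanoutFn (dupDescFn ∘ fanoutFn (lenBinF ∘ DU P) (nU))
    (appF ∘ fanoutFn (notBitsFn ∘ lenBinF ∘ pos1U P)
      (appF ∘ fanoutFn (notsDescFn ∘ fanoutFn (lenBinF ∘ pos2U P) (twoKU))
        (appF ∘ fanoutFn (notBitsFn ∘ lenBinF ∘ pos3U P)
          (shiftDescFn ∘ fanoutFn (fanoutFn (lenBinF ∘ SU P) (lenBinF ∘ pos4U P)) (ylU P)))))

/-- **The description of the conjugating swap of stage `k`.** [folklore] -/
def swF : List Bool → List Bool := SwapDesc.swapDescFn ∘ fanoutFn (lenBinF ∘ DU P) (BwU P)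

/-- **The description of the stage circuit**: the body of `S.descFn` at `1^{il n k}`. [folklore] -/
def copyF : List Bool → List Bool := sndF ∘ sndF ∘ P.S.descFn ∘ ilU P

/-- **The piece of index `k`**: assembly, swap, stage, swap. [folklore] -/
def pieceF : List Bool → List Bool :=
  appF ∘ fanoutFn (inF P) (appF ∘ fanoutFn (swF P) (appF ∘ fanoutFn (copyF P) (swF P)))

variable {P} (z r : List Bool) (k : ℕ)

/-- The record of index `k`. -/
local notation "rec" => boolPair (boolPair z r) (ones k)

/-- Value of `zF`. [folklore] -/
@[simp] theorem zF_rec : zF rec = z := by simp [zF]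

/-- Value of `BwU`. [folklore] -/
@[simp] theorem BwU_rec : BwU P rec = ones (Bw P z.length) := by simp [BwU]

/-- Value of `DU`: `1^{blk k 0}`. [folklore] -/
@[simp] theorem DU_rec : DU P rec = ones (blk P z.length k 0) := by
  have h : DU P rec = umulFn (boolPair (ones (Bw P z.length)) (ones (k + 1))) := by
    unfold DU
    rw [Function.comp_apply, fanoutFn_apply, Function.comp_apply, BwU_rec, sndF_boolPair]
    rfl
  rw [h, umulFn_boolPair, show Bw P z.length * (k + 1) = blk P z.length k 0 by unfold blk base; ring]

/-- Value of `SU`: `1^{Bw · k}`. [folklore] -/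
@[simp] theorem SU_rec : SU P rec = ones (Bw P z.length * k) := by
  have h : SU P rec = umulFn (boolPair (ones (Bw P z.length)) (ones k)) := by simp [SU, fanoutFn_apply, ones]
  rw [h, umulFn_boolPair]

/-- Value of `nU`. [folklore] -/
@[simp] theorem nU_rec : nU rec = ones z.length := by simp [nU]

/-- Value of `twoNU`. [folklore] -/
@[simp] theorem twoNU_rec : twoNU rec = ones (2 * z.length) := by simp [twoNU]

/-- Value of `twoKU`. [folklore] -/
@[simp] theorem twoKU_rec : twoKU rec = ones (2 * k) := by
  simp only [twoKU, Function.comp_apply, fanoutFn_apply, sndF_boolPair, appF_boolPair, ones, ← List.replicate_add]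
  congr 1; omega

/-- Value of `ylU`: `1^{yl n k}`. [folklore] -/
@[simp] theorem ylU_rec : ylU P rec = ones (yl P z.length k) := by
  unfold ylU yl mn
  have hc : (ltLenF ∘ fanoutFn (fun _ => []) sndF) rec = [decide (0 < k)] := by
    simp [fanoutFn_apply, ones]
  by_cases hk : k = 0
  · subst hk; rw [iteFn_apply_false (by rw [hc]; rfl), if_pos rfl]; rfl
  · rw [iteFn_apply_true (by rw [hc]; simp [Nat.pos_of_ne_zero hk]), if_neg hk]; simp

/-- Length of `pos1U`. [folklore] -/
@[simp] theorem length_pos1U_rec : (pos1U P rec).length = blk P z.length k 0 + (2 * z.length + 1) := by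
  simp [pos1U, fanoutFn_apply, ones]; ring

/-- Length of `pos2U`. [folklore] -/
@[simp] theorem length_pos2U_rec : (pos2U P rec).length = blk P z.length k 0 + (2 * z.length + 2) := by
  simp [pos2U]; ring

/-- Length of `pos3U`. [folklore] -/
@[simp] theorem length_pos3U_rec : (pos3U P rec).length = blk P z.length k 0 + (2 * z.length + 2 * k + 3) := by
  simp [pos3U, fanoutFn_apply, ones]; ring

/-- Length of `pos4U`. [folklore] -/
@[simp] theorem length_pos4U_rec : (pos4U P rec).length = blk P z.length k 0 + (2 * z.length + 2 * k + 4) := by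
  simp [pos4U]; ring

/-- Length of `ilU`: the stage input length. [folklore] -/
@[simp] theorem length_ilU_rec : (ilU P rec).length = il P z.length k := by
  simp [ilU, fanoutFn_apply, ones, il]; ring

/-- **`inF` computes the description of the input assembly.** [folklore] -/
theorem inF_rec : inF P rec = (progIn P z.length k).flatMap opBits := by
  rw [flatMap_opBits_progIn]
  simp only [inF, Function.comp_apply, fanoutFn_apply, appF_boolPair, lenBinF_apply, DU_rec, nU_rec, length_pos1U_rec,
    length_pos2U_rec, length_pos3U_rec, length_pos4U_rec, SU_rec, twoKU_rec, ylU_rec, notBitsFn_apply, notsDescFn_apply,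
    shiftDescFn_apply, ones, List.length_replicate]
  rw [dupDescFn_apply]
  have hS : Bw P z.length * k = blk P z.length (k - 1) 0 ∨ yl P z.length k = 0 := by
    rcases k with _ | k'
    · exact Or.inr (yl_zero _)
    · left; unfold blk base; simp only [Nat.add_sub_cancel]; ring
  congr 4
  rcases hS with h | h
  · rw [h]
  · rw [h]; rfl

/-- **`swF` computes the description of the conjugating swap.** [folklore] -/
theorem swF_rec : swF P rec = (progConj P z.length k).flatMap opBits := by
  rw [flatMap_opBits_progConj]
  simp [swF, fanoutFn_apply, ones]

/-- **`copyF` computes the description of the stage circuit.** [folklore] -/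
theorem copyF_rec (hk : k < Tn P z.length) : copyF P rec = (copyGates P z.length k).flatMap gateEnc := by
  rw [flatMap_gateEnc_copyGates hk, copyF]
  simp only [Function.comp_apply, CWrap.sndF_sndF_descFn]
  rw [length_ilU_rec]

/-- **The piece of index `k < T n` is the description of stage `k`.** [folklore] -/
theorem pieceF_rec (hk : k < Tn P z.length) : pieceF P rec = (stageGates P z.length k).flatMap gateEnc := by
  rw [stageGates, List.flatMap_append, List.flatMap_append, List.flatMap_append, flatMap_gateEnc_inGates hk,
    flatMap_gateEnc_conjGates hk, ← inF_rec z r k, ← swF_rec z r k, ← copyF_rec z r k hk]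
  simp [pieceF, fanoutFn_apply]

/-- `zF ∈ FP`. [folklore] -/
theorem zF_mem_FP : zF ∈ FP := comp_mem_FP fstF_mem_FP fstF_mem_FP

/-- `BwU ∈ FP`. [folklore] -/
theorem BwU_mem_FP : BwU P ∈ FP := comp_mem_FP (polyFn_mem_FP _) zF_mem_FP

/-- `DU ∈ FP`. [folklore] -/
theorem DU_mem_FP : DU P ∈ FP := comp_mem_FP umulFn_mem_FP (fanoutFn_mem_FP BwU_mem_FP (comp_mem_FP (cons_mem_FP true) sndF_mem_FP))

/-- `SU ∈ FP`. [folklore] -/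
theorem SU_mem_FP : SU P ∈ FP := comp_mem_FP umulFn_mem_FP (fanoutFn_mem_FP BwU_mem_FP sndF_mem_FP)

/-- `nU ∈ FP`. [folklore] -/
theorem nU_mem_FP : nU ∈ FP := comp_mem_FP (polyFn_mem_FP _) zF_mem_FP

/-- `twoNU ∈ FP`. [folklore] -/
theorem twoNU_mem_FP : twoNU ∈ FP := comp_mem_FP (polyFn_mem_FP _) zF_mem_FP

/-- `twoKU ∈ FP`. [folklore] -/
theorem twoKU_mem_FP : twoKU ∈ FP := comp_mem_FP appF_mem_FP (fanoutFn_mem_FP sndF_mem_FP sndF_mem_FP)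

/-- `ylU ∈ FP`. [folklore] -/
theorem ylU_mem_FP : ylU P ∈ FP :=
  iteFn_mem_FP (comp_mem_FP ltLenF_mem_FP (fanoutFn_mem_FP (const_mem_FP _) sndF_mem_FP))
    (comp_mem_FP (polyFn_mem_FP _) zF_mem_FP) (const_mem_FP _)

/-- `pos1U ∈ FP`. [folklore] -/
theorem pos1U_mem_FP : pos1U P ∈ FP :=
  comp_mem_FP appF_mem_FP (fanoutFn_mem_FP DU_mem_FP (comp_mem_FP (cons_mem_FP true) twoNU_mem_FP))

/-- `pos2U ∈ FP`. [folklore] -/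
theorem pos2U_mem_FP : pos2U P ∈ FP := comp_mem_FP (cons_mem_FP true) pos1U_mem_FP

/-- `pos3U ∈ FP`. [folklore] -/
theorem pos3U_mem_FP : pos3U P ∈ FP :=
  comp_mem_FP (cons_mem_FP true) (comp_mem_FP appF_mem_FP (fanoutFn_mem_FP pos2U_mem_FP twoKU_mem_FP))

/-- `pos4U ∈ FP`. [folklore] -/
theorem pos4U_mem_FP : pos4U P ∈ FP := comp_mem_FP (cons_mem_FP true) pos3U_mem_FP

/-- `ilU ∈ FP`. [folklore] -/
theorem ilU_mem_FP : ilU P ∈ FP :=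
  comp_mem_FP appF_mem_FP (fanoutFn_mem_FP twoNU_mem_FP (comp_mem_FP appF_mem_FP (fanoutFn_mem_FP twoKU_mem_FP
    (comp_mem_FP appF_mem_FP (fanoutFn_mem_FP (const_mem_FP _) ylU_mem_FP)))))

/-- `inF ∈ FP`. [folklore] -/
theorem inF_mem_FP : inF P ∈ FP :=
  comp_mem_FP appF_mem_FP (fanoutFn_mem_FP (comp_mem_FP dupDescFn_mem_FP (fanoutFn_mem_FP (comp_mem_FP lenBinF_mem_FP DU_mem_FP) nU_mem_FP))
    (comp_mem_FP appF_mem_FP (fanoutFn_mem_FP (comp_mem_FP notBitsFn_mem_FP (comp_mem_FP lenBinF_mem_FP pos1U_mem_FP))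
      (comp_mem_FP appF_mem_FP (fanoutFn_mem_FP
        (comp_mem_FP notsDescFn_mem_FP (fanoutFn_mem_FP (comp_mem_FP lenBinF_mem_FP pos2U_mem_FP) twoKU_mem_FP))
        (comp_mem_FP appF_mem_FP (fanoutFn_mem_FP (comp_mem_FP notBitsFn_mem_FP (comp_mem_FP lenBinF_mem_FP pos3U_mem_FP))
          (comp_mem_FP shiftDescFn_mem_FP (fanoutFn_mem_FP (fanoutFn_mem_FP (comp_mem_FP lenBinF_mem_FP SU_mem_FP)
            (comp_mem_FP lenBinF_mem_FP pos4U_mem_FP)) ylU_mem_FP)))))))))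

/-- `swF ∈ FP`. [folklore] -/
theorem swF_mem_FP : swF P ∈ FP :=
  comp_mem_FP SwapDesc.swapDescFn_mem_FP (fanoutFn_mem_FP (comp_mem_FP lenBinF_mem_FP DU_mem_FP) BwU_mem_FP)

/-- `copyF ∈ FP` for a uniform stage family. [folklore] -/
theorem copyF_mem_FP (hU : P.S.IsUniform) : copyF P ∈ FP :=
  comp_mem_FP sndF_mem_FP (comp_mem_FP sndF_mem_FP (comp_mem_FP (QCircuitFamily.descFn_mem_FP_of_isUniform hU) ilU_mem_FP))

/-- `pieceF ∈ FP` for a uniform stage family. [folklore] -/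
theorem pieceF_mem_FP (hU : P.S.IsUniform) : pieceF P ∈ FP :=
  comp_mem_FP appF_mem_FP (fanoutFn_mem_FP inF_mem_FP (comp_mem_FP appF_mem_FP (fanoutFn_mem_FP swF_mem_FP
    (comp_mem_FP appF_mem_FP (fanoutFn_mem_FP (copyF_mem_FP hU) swF_mem_FP)))))

end Piece

/-! ### Size bookkeeping for the ruler -/

section Bounds

variable {n k : ℕ}

/-- Block `k` and one more block fit: `blk k 0 + Bw ≤ W`. [folklore] -/
theorem blk_add_Bw_le_W (hk : k < Tn P n) : blk P n k 0 + Bw P n ≤ W P n := by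
  unfold blk W base
  have : (k + 1) * Bw P n ≤ Tn P n * Bw P n := Nat.mul_le_mul_right _ hk
  nlinarith

/-- Every position of the stage input of block `k` is a wire: `blk k 0 + il k ≤ W`. [folklore] -/
theorem blk_add_il_le_W (hk : k < Tn P n) : blk P n k 0 + il P n k ≤ W P n :=
  (Nat.add_le_add_left (il_lt_Bw hk).le _).trans (blk_add_Bw_le_W hk)

/-- `2 T n ≤ W n` and `n ≤ W n` and `m n ≤ W n` and `Bw n ≤ W n`. [folklore] -/
theorem misc_le_W (hk : k < Tn P n) : 2 * Tn P n ≤ W P n ∧ n ≤ W P n ∧ mn P n ≤ W P n ∧ Bw P n ≤ W P n := by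
  have h0 : k < Tn P n := hk
  have h1 : Lmax P n ≤ Bw P n := by unfold Bw; omega
  have h2 : Bw P n ≤ W P n := base_le_W n
  unfold Lmax at h1
  exact ⟨by omega, by omega, by omega, h2⟩

end Bounds

/-! ### The fold over the stages -/

section Fold

variable (P) (p₁ p₂ p₃ p₄ ps pd : Polynomial ℕ)

/-- The ruler polynomial: room for the rounds and for every piece. [folklore] -/
def rulerPoly : Polynomial ℕ :=
  P.T + ((p₁ + C 2 * p₂ + p₃ + p₄ + C 2 * ps).comp (C 7 * WPoly P + C 8) + pd.comp (LmaxPoly P))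

/-- The initial record of the fold: `⟨⟨z, ruler⟩, ⟨bin (T n), ⟨1⁰, []⟩⟩⟩`. [folklore] -/
def initQ : List Bool → List Bool :=
  fanoutFn (fanoutFn (fun z => z) (polyFn (rulerPoly P p₁ p₂ p₃ p₄ ps pd))) (fanoutFn (lenBinF ∘ polyFn P.T) (fun _ => boolPair [] []))

/-- **The description of the stages** as a string function: fold the pieces `k < T n`.
[cite: AroraBarak2009, §1.3 (bounded loops)] -/
def sqF : List Bool → List Bool := sndPow 2 ∘ foldLoop appF (clipF 1 (pieceF P)) X ∘ initQ P p₁ p₂ p₃ p₄ ps pd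

variable {P}

/-- `sqF ∈ FP`. [folklore] -/
theorem sqF_mem_FP (hU : P.S.IsUniform) : sqF P p₁ p₂ p₃ p₄ ps pd ∈ FP :=
  comp_mem_FP (sndPow_mem_FP 2) (comp_mem_FP (foldLoop_clipF_mem_FP 1 appF_mem_FP length_appF_le (pieceF_mem_FP hU) X)
    (fanoutFn_mem_FP (fanoutFn_mem_FP (PolyTimeComputable.id _) (polyFn_mem_FP _))
      (fanoutFn_mem_FP (comp_mem_FP lenBinF_mem_FP (polyFn_mem_FP _)) (const_mem_FP _))))

/-- **Actual pieces are within the ruler.** For `k < T |z|`, with the six length bounds of the printed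
functions, `|pieceF ⟨⟨z, r⟩, 1ᵏ⟩| ≤ ruler(|z|) - T|z|`. [folklore] -/
theorem length_pieceF_le (hp₁ : ∀ v, (dupDescFn v).length ≤ p₁.eval v.length) (hp₂ : ∀ v, (notBitsFn v).length ≤ p₂.eval v.length)
    (hp₃ : ∀ v, (notsDescFn v).length ≤ p₃.eval v.length) (hp₄ : ∀ v, (shiftDescFn v).length ≤ p₄.eval v.length)
    (hps : ∀ v, (SwapDesc.swapDescFn v).length ≤ ps.eval v.length) (hpd : ∀ u, (P.S.descFn u).length ≤ pd.eval u.length)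
    (z r : List Bool) {k : ℕ} (hk : k < Tn P z.length) :
    (pieceF P (boolPair (boolPair z r) (ones k))).length + Tn P z.length ≤ (rulerPoly P p₁ p₂ p₃ p₄ ps pd).eval z.length := by
  set n := z.length with hn
  set A := 7 * W P n + 8 with hA
  have hW := blk_add_il_le_W (P := P) hk
  obtain ⟨h2T, hnW, hmW, hBW⟩ := misc_le_W (P := P) hk
  have hil : 2 * n + 2 * k + 4 + yl P n k = il P n k := rfl
  have hD : blk P n k 0 ≤ W P n := by omega
  have hS : Bw P n * k ≤ W P n := by
    have : Bw P n * k ≤ blk P n k 0 := by unfold blk base; nlinarith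
    omega
  have hylm : yl P n k ≤ mn P n := yl_le n k
  have hbin : ∀ t, t ≤ W P n → (encodeNat t).length ≤ W P n := fun t ht => (length_encodeNat_le_self t).trans ht
  -- the record values
  have e : pieceF P (boolPair (boolPair z r) (ones k)) =
      (dupDescFn (boolPair (encodeNat (blk P n k 0)) (ones n)) ++
        (notBitsFn (encodeNat (blk P n k 0 + (2 * n + 1))) ++
          (notsDescFn (boolPair (encodeNat (blk P n k 0 + (2 * n + 2))) (ones (2 * k))) ++
            (notBitsFn (encodeNat (blk P n k 0 + (2 * n + 2 * k + 3))) ++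
              shiftDescFn (boolPair (boolPair (encodeNat (Bw P n * k)) (encodeNat (blk P n k 0 + (2 * n + 2 * k + 4)))) (ones (yl P n k))))))) ++
      (SwapDesc.swapDescFn (boolPair (encodeNat (blk P n k 0)) (ones (Bw P n))) ++
        (sndF (sndF (P.S.descFn (ilU P (boolPair (boolPair z r) (ones k))))) ++
          SwapDesc.swapDescFn (boolPair (encodeNat (blk P n k 0)) (ones (Bw P n))))) := by
    simp only [pieceF, inF, swF, copyF, Function.comp_apply, fanoutFn_apply, appF_boolPair, lenBinF_apply, DU_rec, nU_rec,
      BwU_rec, SU_rec, twoKU_rec, ylU_rec, length_pos1U_rec, length_pos2U_rec, length_pos3U_rec, length_pos4U_rec, ← hn,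
      ones, List.length_replicate]
  -- the six bounds
  have b1 : (dupDescFn (boolPair (encodeNat (blk P n k 0)) (ones n))).length ≤ p₁.eval A := by
    refine (hp₁ _).trans (TM2Iter.eval_mono _ ?_)
    rw [length_boolPair]; have := hbin _ hD; simp [ones]; omega
  have b2 : (notBitsFn (encodeNat (blk P n k 0 + (2 * n + 1)))).length ≤ p₂.eval A := by
    refine (hp₂ _).trans (TM2Iter.eval_mono _ ?_)
    have := hbin (blk P n k 0 + (2 * n + 1)) (by omega); omega
  have b3 : (notsDescFn (boolPair (encodeNat (blk P n k 0 + (2 * n + 2))) (ones (2 * k)))).length ≤ p₃.eval A := by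
    refine (hp₃ _).trans (TM2Iter.eval_mono _ ?_)
    rw [length_boolPair]; have := hbin (blk P n k 0 + (2 * n + 2)) (by omega); simp [ones]; omega
  have b4 : (notBitsFn (encodeNat (blk P n k 0 + (2 * n + 2 * k + 3)))).length ≤ p₂.eval A := by
    refine (hp₂ _).trans (TM2Iter.eval_mono _ ?_)
    have := hbin (blk P n k 0 + (2 * n + 2 * k + 3)) (by omega); omega
  have b5 : (shiftDescFn (boolPair (boolPair (encodeNat (Bw P n * k)) (encodeNat (blk P n k 0 + (2 * n + 2 * k + 4))))
      (ones (yl P n k)))).length ≤ p₄.eval A := by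
    refine (hp₄ _).trans (TM2Iter.eval_mono _ ?_)
    rw [length_boolPair, length_boolPair]
    have := hbin _ hS; have := hbin (blk P n k 0 + (2 * n + 2 * k + 4)) (by omega); simp [ones]; omega
  have b6 : (SwapDesc.swapDescFn (boolPair (encodeNat (blk P n k 0)) (ones (Bw P n)))).length ≤ ps.eval A := by
    refine (hps _).trans (TM2Iter.eval_mono _ ?_)
    rw [length_boolPair]; have := hbin _ hD; simp [ones]; omega
  have b7 : (sndF (sndF (P.S.descFn (ilU P (boolPair (boolPair z r) (ones k)))))).length ≤ pd.eval (Lmax P n) := by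
    have h := hpd (ilU P (boolPair (boolPair z r) (ones k)))
    rw [QCircuitFamily.descFn_eq, length_boolPair, length_boolPair, length_ilU_rec, ← hn] at h
    rw [CWrap.sndF_sndF_descFn, length_ilU_rec, ← hn]
    exact (by omega : _ ≤ pd.eval (il P n k)).trans (TM2Iter.eval_mono _ (il_le_Lmax hk))
  rw [e]
  simp only [List.length_append]
  have hr : (rulerPoly P p₁ p₂ p₃ p₄ ps pd).eval n =
      Tn P n + ((p₁.eval A + 2 * p₂.eval A + p₃.eval A + p₄.eval A + 2 * ps.eval A) + pd.eval (Lmax P n)) := by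
    simp [rulerPoly, Polynomial.eval_comp, hA, Tn]
  rw [hr]
  omega

/-- **The fold computes the description of the stages**, given the six length bounds. [folklore] -/
theorem sqF_apply (hp₁ : ∀ v, (dupDescFn v).length ≤ p₁.eval v.length) (hp₂ : ∀ v, (notBitsFn v).length ≤ p₂.eval v.length)
    (hp₃ : ∀ v, (notsDescFn v).length ≤ p₃.eval v.length) (hp₄ : ∀ v, (shiftDescFn v).length ≤ p₄.eval v.length)
    (hps : ∀ v, (SwapDesc.swapDescFn v).length ≤ ps.eval v.length) (hpd : ∀ u, (P.S.descFn u).length ≤ pd.eval u.length)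
    (z : List Bool) :
    sqF P p₁ p₂ p₃ p₄ ps pd z = (stagesGates P z.length (Tn P z.length)).flatMap gateEnc := by
  set n := z.length with hn
  set ctx := boolPair z (ones ((rulerPoly P p₁ p₂ p₃ p₄ ps pd).eval n)) with hctx
  have hinit : initQ P p₁ p₂ p₃ p₄ ps pd z = boolPair ctx (boolPair (encodeNat (Tn P n)) (boolPair (ones 0) [])) := by
    simp [initQ, fanoutFn_apply, hctx, hn, ones, Tn]
  have hrounds : Tn P n ≤ (X : Polynomial ℕ).eval ctx.length := by
    rw [eval_X, hctx, length_boolPair]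
    have : Tn P n ≤ (rulerPoly P p₁ p₂ p₃ p₄ ps pd).eval n := by simp [rulerPoly, Tn]
    simp [ones]; omega
  have hpiece : ∀ j, 0 ≤ j → j < 0 + Tn P n → (pieceF P (boolPair ctx (ones j))).length ≤ 1 * (ctx.length + 1) := by
    intro j _ hj
    have hjT : j < Tn P z.length := by rw [← hn]; omega
    have h := length_pieceF_le p₁ p₂ p₃ p₄ ps pd hp₁ hp₂ hp₃ hp₄ hps hpd z (ones ((rulerPoly P p₁ p₂ p₃ p₄ ps pd).eval n)) hjT
    rw [hctx, length_boolPair]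
    simp only [ones, List.length_replicate, one_mul, ← hn] at h ⊢
    omega
  rw [sqF, Function.comp_apply, Function.comp_apply, hinit, foldLoop_apply appF (clipF 1 (pieceF P)) hrounds 0 [],
    sndPow_succ_boolPair, sndPow_succ_boolPair, sndPow_zero_boolPair, foldAcc_clipF hpiece, foldAcc_appF, List.nil_append,
    stagesGates, List.flatMap_assoc, CWrap.flatMap_range_eq_ccat]
  refine ccat_congr fun j hj => ?_
  rw [Nat.zero_add, hctx, pieceF_rec z _ j (by rw [← hn]; exact hj), ← hn]

end Fold

/-! ### The final swap, the header, and the assembly -/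

variable (P)

/-- **The description of the final swap**: nothing when there is no stage, else the swap of the front
window with the last block (offset `Bw · T n`). [folklore] -/
def finalF : List Bool → List Bool :=
  iteFn (ltLenF ∘ fanoutFn (fun _ => []) (polyFn P.T))
    (SwapDesc.swapDescFn ∘ fanoutFn (lenBinF ∘ umulFn ∘ fanoutFn (polyFn (BwPoly P)) (polyFn P.T)) (polyFn (BwPoly P)))
    (fun _ => [])

/-- The ancilla count in unary: `1^{W n}` with the first `n` symbols dropped. [folklore] -/
def ancF : List Bool → List Bool := dropFn ∘ fanoutFn (fun z => z) (polyFn (WPoly P))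

variable {P}

/-- **`finalF` computes the description of the final swap.** [folklore] -/
theorem finalF_apply (z : List Bool) : finalF P z = (finalGates P z.length).flatMap gateEnc := by
  have hc : (ltLenF ∘ fanoutFn (fun _ => []) (polyFn P.T)) z = [decide (0 < Tn P z.length)] := by
    simp [fanoutFn_apply, ones, Tn]
  unfold finalF finalGates conjGates
  rcases Nat.eq_zero_or_pos (Tn P z.length) with hT | hT
  · rw [iteFn_apply_false (by rw [hc, hT]; rfl), dif_neg (by rw [hT]; omega)]
    rfl
  · rw [iteFn_apply_true (by rw [hc]; simp [hT]), dif_pos (last_lt P hT), flatMap_gateEnc_clamp, flatMap_opBits_progConj]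
    simp only [Function.comp_apply, fanoutFn_apply, polyFn_apply, eval_BwPoly, umulFn_boolPair, lenBinF_apply, ones,
      List.length_replicate]
    congr 3
    unfold blk base Tn
    have := Nat.sub_add_cancel hT
    unfold Tn at this
    nlinarith [this]

/-- `finalF ∈ FP`. [folklore] -/
theorem finalF_mem_FP : finalF P ∈ FP :=
  iteFn_mem_FP (comp_mem_FP ltLenF_mem_FP (fanoutFn_mem_FP (const_mem_FP _) (polyFn_mem_FP _)))
    (comp_mem_FP SwapDesc.swapDescFn_mem_FP (fanoutFn_mem_FP
      (comp_mem_FP lenBinF_mem_FP (comp_mem_FP umulFn_mem_FP (fanoutFn_mem_FP (polyFn_mem_FP _) (polyFn_mem_FP _)))) (polyFn_mem_FP _)))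
    (const_mem_FP _)

/-- Value of `ancF`. [folklore] -/
theorem ancF_apply (z : List Bool) : ancF P z = unaryEncodeNat (anc P z.length) := by
  simp only [ancF, Function.comp_apply, fanoutFn_apply, dropFn_boolPair, polyFn_apply, eval_WPoly, ones, List.drop_replicate, anc]
  exact (RevDesc.unaryEncodeNat_eq_replicate _).symm

/-- `ancF ∈ FP`. [folklore] -/
theorem ancF_mem_FP : ancF P ∈ FP := comp_mem_FP dropFn_mem_FP (fanoutFn_mem_FP (PolyTimeComputable.id _) (polyFn_mem_FP _))

variable (P)

/-- **The chain family is polynomial-time uniform** (if the stage family is). [cite: AroraBarak2009, §6.2 Def. 6.12 and Remark 6.7 (descriptions printed in polynomial time)] -/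
theorem family_isUniform (hU : P.S.IsUniform) : (family P).IsUniform := by
  obtain ⟨p₁, hp₁⟩ := exists_poly_length_le_of_mem_FP dupDescFn_mem_FP
  obtain ⟨p₂, hp₂⟩ := exists_poly_length_le_of_mem_FP notBitsFn_mem_FP
  obtain ⟨p₃, hp₃⟩ := exists_poly_length_le_of_mem_FP notsDescFn_mem_FP
  obtain ⟨p₄, hp₄⟩ := exists_poly_length_le_of_mem_FP shiftDescFn_mem_FP
  obtain ⟨ps, hps⟩ := exists_poly_length_le_of_mem_FP SwapDesc.swapDescFn_mem_FP
  obtain ⟨pd, hpd⟩ := exists_poly_length_le_of_mem_FP (QCircuitFamily.descFn_mem_FP_of_isUniform hU)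
  refine QCircuitFamily.isUniform_of_descFn_mem_FP ?_
  have h := fanoutFn_mem_FP lenBinF_mem_FP (fanoutFn_mem_FP (ancF_mem_FP (P := P))
    (append_mem_FP (sqF_mem_FP p₁ p₂ p₃ p₄ ps pd hU) (finalF_mem_FP (P := P))))
  have e : (family P).descFn = fanoutFn lenBinF (fanoutFn (ancF P)
      (fun z => sqF P p₁ p₂ p₃ p₄ ps pd z ++ finalF P z)) := by
    funext z
    have henc : (circ P z.length).encode = (stagesGates P z.length (Tn P z.length) ++ finalGates P z.length).flatMap gateEnc := by
      unfold circ; exact encode_eq_flatMap _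
    rw [fanoutFn_apply, fanoutFn_apply, lenBinF_apply, ancF_apply, sqF_apply p₁ p₂ p₃ p₄ ps pd hp₁ hp₂ hp₃ hp₄ hps hpd,
      finalF_apply, QCircuitFamily.descFn_eq]
    dsimp only [family_circ, family_ancillas]
    rw [henc, List.flatMap_append]
  rw [e]
  exact h

end Uniform

end SeqChain

end Literature.Computability.QuantumComplexity

end
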